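import Summits.AtomisticToContinuum.HydrodynamicLimit.Theorems.OneFlightGossipEngineEnergyCurrentTailsSplitDeficitRung0Prelim
import HarnessLib

/-!
# Crux `EnergyCurrentTails` (stmt-AtomisticToContinuum-9235), line `quartic-schur-ledger`:
# rung-0 certificate of the split deficit SD (`stub_quarticSplitDeficitRung0`)

At GLOBAL EQUILIBRIUM with drift (`G_N = localGibbsLaw σ a u θ̄ N (Φ N)`, constant profiles) the
split-deficit inequality SD of the line holds with an `N`-independent `δ > 0`, for all `N ≥ N₀` and
all windows `0 ≤ s ≤ t`:
`δ · E_G[Σ_{coll ∈ (s,t]} Σ_{i≠j in contact} (N+1)⁻¹ (‖vᵢ⁺‖²+‖vⱼ⁺‖²)²]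
   ≤ E_G[Σ_{coll ∈ (s,t]} Σ_{i≠j in contact} (N+1)⁻¹ 2‖vᵢ⁺‖²‖vⱼ⁺‖²]`.

Route (bounds; every tool landed).  UPPER: the left functional is the collision pair sum of the
post-velocity mark `(N+1)⁻¹(‖v‖²+‖w‖²)²`, bounded in `G_N`-mean by the rung-0 flux ceiling
`localGibbsLaw_lintegral_le_of_le_collisionMarkSum` (p98294): `≤ 16 (t−s)(N+1)²ε² (N+1)⁻¹ V₁`,
`V₁ = ∫‖w−v‖(‖v‖²+‖w‖²)² dN(u,θ̄)^{⊗2} < ∞`.  LOWER: seat c2's rung-0 SPLITTING FLOOR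
`stub_splitFloorRung0` (p112692) as a black box — at a fixed level `E ≥ E_th`,
`E#{splitting collisions in (s,t]} ≥ c κ_N √E (t−s) (N+1) N(u,θ̄)(shell)` — and the pathwise comparison
of ONE collision: on the splitting event (`‖v₁⁺‖², ‖v₂⁺‖² ≤ E < ‖v₁⁻‖² ∨ ‖v₂⁻‖²`) either the pair
energy `T = ‖v₁⁺‖²+‖v₂⁺‖²` lies in the THIN SHELL `(E, (1+η)E)`, or `2‖v₁⁺‖²‖v₂⁺‖² ≥ 2ηE²`
(`c5sd_splitIndicator_le`); the thin shell is a collision-invariant (post-velocity) mark whose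
`G_N`-mean is again bounded by the flux ceiling, by `16(t−s)(N+1)²ε² Θ(η)` with `Θ(η) → 0` as
`η → 0` (continuity from above of the finite flux measure `‖w−v‖ N^{⊗2}`, `c5sd_tendsto_thinFlux`).
Choosing `η` with `32 Θ(η) < c√E N(shell)` leaves `E[right] ≥ κ₀ (N+1)ε² (t−s)` with `κ₀ > 0`
independent of `N`, whence `δ = κ₀/(16 V₁ + 1)`.  The tools (window flux ceiling, Gaussian statics,
thin-shell flux, the one-collision comparison and its expectation form, the registered helper
`splitDeficitRung0_eventCount_le`, and the bridge from the routes' inline `∑ᶠ` form) are in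
`…Theorems.OneFlightGossipEngineEnergyCurrentTailsSplitDeficitRung0Prelim`.

References: Cercignani–Illner–Pulvirenti 1994, §2.2 and App. 4.A (collision flux through contact
cylinders); Gallagher–Saint-Raymond–Texier 2013, Prop. 4.1.1.
-/

noncomputable section

open MeasureTheory Set Filter Topology
open scoped ENNReal InnerProductSpace

namespace Summit.AtomisticToContinuum.HydrodynamicLimit.Theorems.QuarticSchurLedger

open Literature.MathematicalPhysics.KineticTheory Literature.Analysis.FluidPDE
open Literature.Analysis.FunctionSpaces
open Summit.AtomisticToContinuum.HydrodynamicLimit.Theorems.EnergyCurrentTailsLevelCensus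

/-! ### The certificate in collision-pair-sum form -/

/-- **The split deficit at rung 0 — collision-pair-sum form.**  For constant profiles `a, θ̄ > 0`,
constant drift `u`, there is `σ₀ > 0` such that for `0 < σ < σ₀` and every flow family `Φ` there are
`δ > 0` and `N₀` with, for all `N ≥ N₀` and `0 ≤ s ≤ t`,
`δ · E_{G_N}[CPS_{(s,t]}((N+1)⁻¹(‖vᵢ⁺‖²+‖vⱼ⁺‖²)²)] ≤ E_{G_N}[CPS_{(s,t]}((N+1)⁻¹ 2‖vᵢ⁺‖²‖vⱼ⁺‖²)]`
(flux ceiling for the left side and the thin shell; splitting floor `stub_splitFloorRung0` and the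
pathwise comparison `splitDeficitRung0_eventCount_le` for the right side). [folklore] -/
theorem c5sd_core (a θb : ℝ) (u : V3) (ha : 0 < a) (hθ : 0 < θb) :
    ∃ σ₀ : ℝ, 0 < σ₀ ∧ ∀ σ : ℝ, 0 < σ → σ < σ₀ →
      ∀ Φ : ((N : ℕ) → HardSphereFlow (Torus.geometry (Fin 3)) (hsDiameter σ N) (N + 1)),
        ∃ δ : ℝ, 0 < δ ∧ ∃ N₀ : ℕ, ∀ N : ℕ, N₀ ≤ N → ∀ s t : ℝ, 0 ≤ s → s ≤ t →
          ENNReal.ofReal δ * (∫⁻ z, (Φ N).collisionPairSum (Ioc s t) (fun _ w i j =>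
              ENNReal.ofReal (((N + 1 : ℕ) : ℝ)⁻¹ * (‖(w i).2‖ ^ 2 + ‖(w j).2‖ ^ 2) ^ 2)) z
            ∂(localGibbsLaw σ (fun _ => a) (fun _ => u) (fun _ => θb) N (Φ N))) ≤
          ∫⁻ z, (Φ N).collisionPairSum (Ioc s t) (fun _ w i j =>
              ENNReal.ofReal (((N + 1 : ℕ) : ℝ)⁻¹ * (2 * (‖(w i).2‖ ^ 2 * ‖(w j).2‖ ^ 2)))) z
            ∂(localGibbsLaw σ (fun _ => a) (fun _ => u) (fun _ => θb) N (Φ N)) := by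
  obtain ⟨σA, hσA, hsmallA⟩ := exists_smallDensity uniformProfile one_pos
  obtain ⟨σB, hσB, hfloorB⟩ := stub_splitFloorRung0 a θb u ha hθ
  refine ⟨min σA σB, lt_min hσA hσB, fun σ hσ hσlt Φ => ?_⟩
  have hsm : SmallDensity uniformProfile σ := (hsmallA σ hσ (hσlt.trans_le (min_le_left _ _))).1
  have hσ2 : σ < 1 / 2 := hsm.σ_lt_half
  obtain ⟨c, hc, Eth, N₃, hfloor⟩ := hfloorB σ hσ (hσlt.trans_le (min_le_right _ _)) Φ
  -- the level `E` and the Gaussian constants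
  set E : ℝ := max Eth 1 with hEdef
  have hE : 0 < E := lt_of_lt_of_le one_pos (le_max_right _ _)
  have hEth : Eth ≤ E := le_max_left _ _
  set γS : ℝ≥0∞ := gaussMeasure u θb {v : V3 | E < ‖v‖ ^ 2 ∧ ‖v‖ ^ 2 ≤ 3 / 2 * E} with hγSdef
  have hγS0 : γS ≠ 0 := c5sd_gaussMeasure_shell_ne_zero u hθ hE
  have hγStop : γS ≠ ⊤ := measure_ne_top _ _
  set gS : ℝ := γS.toReal with hgSdef
  have hgS : 0 < gS := ENNReal.toReal_pos hγS0 hγStop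
  have hγSeq : γS = ENNReal.ofReal gS := (ENNReal.ofReal_toReal hγStop).symm
  set I₁ : ℝ≥0∞ := ∫⁻ p, ENNReal.ofReal ‖p.2 - p.1‖ * ENNReal.ofReal ((‖p.1‖ ^ 2 + ‖p.2‖ ^ 2) ^ 2)
    ∂((gaussMeasure u θb).prod (gaussMeasure u θb)) with hI₁def
  have hI₁top : I₁ ≠ ⊤ := c5sd_lintegral_fluxQuartic_ne_top u θb
  set I₁r : ℝ := I₁.toReal with hI₁rdef
  have hI₁r : 0 ≤ I₁r := ENNReal.toReal_nonneg
  have hI₁eq : I₁ = ENNReal.ofReal I₁r := (ENNReal.ofReal_toReal hI₁top).symm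
  -- the thin shell: `η = 1/(n+1)` with `Θ(η) < c √E gS / 32`
  have hlim := c5sd_tendsto_thinFlux u θb hE
  have htarget : (0 : ℝ≥0∞) < ENNReal.ofReal (c * Real.sqrt E * gS / 32) :=
    ENNReal.ofReal_pos.2 (by positivity)
  obtain ⟨n, hn⟩ := ((tendsto_order.1 hlim).2 _ htarget).exists
  set η : ℝ := 1 / ((n : ℝ) + 1) with hηdef
  have hη : 0 < η := by positivity
  -- the constants
  set κ₀ : ℝ := c * Real.sqrt E * gS * (η * E ^ 2) / 2 with hκ₀def
  have hκ₀ : 0 < κ₀ := by positivity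
  set δ : ℝ := κ₀ / (16 * I₁r + 1) with hδdef
  have hδ : 0 < δ := by positivity
  refine ⟨δ, hδ, max N₃ 1, fun N hN s t hs hst => ?_⟩
  have hN₃ : N₃ ≤ N := le_of_max_le_left hN
  have hN1 : 1 ≤ N := le_of_max_le_right hN
  rcases hst.eq_or_lt with heq | hlt
  · -- empty window: the left functional vanishes
    subst heq
    have h0 : ∀ z, (Φ N).collisionPairSum (Ioc s s) (fun _ w i j =>
        ENNReal.ofReal (((N + 1 : ℕ) : ℝ)⁻¹ * (‖(w i).2‖ ^ 2 + ‖(w j).2‖ ^ 2) ^ 2)) z = 0 := by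
      intro z
      unfold HardSphereFlow.collisionPairSum
      rw [Ioc_self, collisionPairSum_empty]
    simp only [h0, lintegral_zero, mul_zero, zero_le]
  -- abbreviations
  set τ : ℝ := t - s with hτdef
  have hτ : 0 < τ := sub_pos.2 hlt
  set ε : ℝ := hsDiameter σ N with hεdef
  have hε : 0 < ε := hsDiameter_pos hσ N
  set P := localGibbsLaw σ (fun _ => a) (fun _ => u) (fun _ => θb) N (Φ N) with hPdef
  set R : ℝ≥0∞ := ∫⁻ z, (Φ N).collisionPairSum (Ioc s t) (fun _ w i j =>
      ENNReal.ofReal (((N + 1 : ℕ) : ℝ)⁻¹ * (2 * (‖(w i).2‖ ^ 2 * ‖(w j).2‖ ^ 2)))) z ∂P with hRdef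
  set Y : ℝ := ((N + 1 : ℕ) : ℝ) * ε ^ 2 * τ with hYdef
  have hY : 0 ≤ Y := by positivity
  set X : ℝ := c * Real.sqrt E * gS * ((N + 1 : ℕ) : ℝ) * Y with hXdef
  have hX : 0 ≤ X := by positivity
  have hNr : ((N + 1 : ℕ) : ℝ) ≠ 0 := by positivity
  -- (U) the flux ceiling of the left functional
  have hALm : Measurable fun q : V3 × V3 =>
      ENNReal.ofReal (((N + 1 : ℕ) : ℝ)⁻¹ * (‖q.1‖ ^ 2 + ‖q.2‖ ^ 2) ^ 2) :=
    ((((measurable_fst.norm.pow_const 2).add (measurable_snd.norm.pow_const 2)).pow_const 2).const_mul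
      _).ennreal_ofReal
  have hU := c5sd_lintegral_collisionPairSum_le hσ hsm ha hθ u hN1 (Φ N) hALm hlt
  dsimp only at hU
  have hIL : ∫⁻ p, ENNReal.ofReal ‖p.2 - p.1‖ *
      ENNReal.ofReal (((N + 1 : ℕ) : ℝ)⁻¹ * (‖p.1‖ ^ 2 + ‖p.2‖ ^ 2) ^ 2)
      ∂((gaussMeasure u θb).prod (gaussMeasure u θb)) = ENNReal.ofReal (((N + 1 : ℕ) : ℝ)⁻¹) * I₁ := by
    rw [hI₁def, ← lintegral_const_mul' _ _ ENNReal.ofReal_ne_top]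
    refine lintegral_congr fun p => ?_
    rw [ENNReal.ofReal_mul (by positivity), mul_left_comm]
  have hL : (∫⁻ z, (Φ N).collisionPairSum (Ioc s t) (fun _ w i j =>
      ENNReal.ofReal (((N + 1 : ℕ) : ℝ)⁻¹ * (‖(w i).2‖ ^ 2 + ‖(w j).2‖ ^ 2) ^ 2)) z ∂P) ≤
      ENNReal.ofReal (16 * τ * ((N + 1 : ℕ) : ℝ) ^ 2 * ε ^ 2) *
        (ENNReal.ofReal (((N + 1 : ℕ) : ℝ)⁻¹) * I₁) := hU.trans (by rw [hIL])
  -- (T) the flux ceiling of the thin shell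
  have hATm : Measurable ({p : V3 × V3 | E < ‖p.1‖ ^ 2 + ‖p.2‖ ^ 2 ∧
      ‖p.1‖ ^ 2 + ‖p.2‖ ^ 2 < (1 + η) * E}.indicator fun _ => (1 : ℝ≥0∞)) :=
    measurable_const.indicator (c5sd_measurableSet_thin E _)
  have hT := c5sd_lintegral_collisionPairSum_le hσ hsm ha hθ u hN1 (Φ N) hATm hlt
  have hTX : (∫⁻ z, (Φ N).collisionPairSum (Ioc s t) (fun _ w i j =>
      {p : V3 × V3 | E < ‖p.1‖ ^ 2 + ‖p.2‖ ^ 2 ∧ ‖p.1‖ ^ 2 + ‖p.2‖ ^ 2 < (1 + η) * E}.indicator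
        (fun _ => (1 : ℝ≥0∞)) ((w i).2, (w j).2)) z ∂P) ≤ ENNReal.ofReal (X / 2) := by
    refine hT.trans ((mul_le_mul_right hn.le _).trans_eq ?_)
    rw [← ENNReal.ofReal_mul (by positivity)]
    congr 1
    rw [hXdef, hYdef]
    ring
  -- (S) the splitting floor and the census at rung 0
  have hS := hfloor N hN₃ s t hs hst E hEth
  rw [← succ_mul_hsDiameter_sq_eq_clock] at hS
  have hcensus : ((N + 1 : ℕ) : ℝ≥0∞) * γS ≤ ⨅ r ∈ Icc s t,
      shellCensus σ (fun _ => a) (fun _ => θb) (fun _ => u) N (Φ N) r E (3 / 2 * E) :=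
    le_iInf₂ fun r _ => (shellCensus_const hσ2.le ha hθ u N (Φ N) r E (3 / 2 * E)).ge
  have hSX : ENNReal.ofReal X ≤
      eventCount σ (fun _ => a) (fun _ => θb) (fun _ => u) N (Φ N) s t (splitEvent E) := by
    calc ENNReal.ofReal X = ENNReal.ofReal (c * (((N + 1 : ℕ) : ℝ) * ε ^ 2) * Real.sqrt E * τ) *
          (((N + 1 : ℕ) : ℝ≥0∞) * γS) := by
          rw [hγSeq, ← ENNReal.ofReal_natCast, ← ENNReal.ofReal_mul (Nat.cast_nonneg _),
            ← ENNReal.ofReal_mul (by positivity)]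
          congr 1
          rw [hXdef, hYdef]
          ring
      _ ≤ ENNReal.ofReal (c * (((N + 1 : ℕ) : ℝ) * ε ^ 2) * Real.sqrt E * τ) *
          ⨅ r ∈ Icc s t, shellCensus σ (fun _ => a) (fun _ => θb) (fun _ => u) N (Φ N) r E (3 / 2 * E) :=
          mul_le_mul_right hcensus _
      _ ≤ _ := hS
  -- (E) the pathwise comparison in expectation
  have hEv := splitDeficitRung0_eventCount_le σ hσ hσ2 (fun _ => a) (fun _ => θb) (fun _ => u) N (Φ N) E η hE hη s t
  set C : ℝ≥0∞ := ENNReal.ofReal (((N + 1 : ℕ) : ℝ) / (η * E ^ 2)) with hCdef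
  -- assembly: `ofReal X ≤ ofReal (X/2) + C R`, so `ofReal (X/2) ≤ C R`
  have hX2 : ENNReal.ofReal (X / 2) ≤ C * R := by
    have h1 : ENNReal.ofReal X ≤ ENNReal.ofReal (X / 2) + C * R :=
      hSX.trans (hEv.trans (add_le_add_left hTX _))
    have hsplit : ENNReal.ofReal X = ENNReal.ofReal (X / 2) + ENNReal.ofReal (X / 2) := by
      rw [← ENNReal.ofReal_add (by positivity) (by positivity), add_halves]
    rw [hsplit] at h1
    exact (ENNReal.add_le_add_iff_left ENNReal.ofReal_ne_top).1 h1
  have hR : ENNReal.ofReal (κ₀ * Y) ≤ R := by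
    have hprod : ENNReal.ofReal (η * E ^ 2 / ((N + 1 : ℕ) : ℝ)) * C = 1 := by
      rw [hCdef, ← ENNReal.ofReal_mul (by positivity), ← ENNReal.ofReal_one]
      congr 1
      field_simp
    calc ENNReal.ofReal (κ₀ * Y)
        = ENNReal.ofReal (η * E ^ 2 / ((N + 1 : ℕ) : ℝ)) * ENNReal.ofReal (X / 2) := by
          rw [← ENNReal.ofReal_mul (by positivity)]
          congr 1
          rw [hκ₀def, hXdef]
          field_simp
      _ ≤ ENNReal.ofReal (η * E ^ 2 / ((N + 1 : ℕ) : ℝ)) * (C * R) := mul_le_mul_right hX2 _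
      _ = R := by rw [← mul_assoc, hprod, one_mul]
  -- the left side: `δ · 16 Y I₁ ≤ κ₀ Y`
  have hZ : δ * (16 * τ * ((N + 1 : ℕ) : ℝ) ^ 2 * ε ^ 2 * ((((N + 1 : ℕ) : ℝ))⁻¹ * I₁r)) ≤ κ₀ * Y := by
    have key : δ * (16 * I₁r) ≤ κ₀ := by
      rw [hδdef, div_mul_eq_mul_div, div_le_iff₀ (by positivity)]
      nlinarith
    have e : δ * (16 * τ * ((N + 1 : ℕ) : ℝ) ^ 2 * ε ^ 2 * ((((N + 1 : ℕ) : ℝ))⁻¹ * I₁r)) =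
        δ * (16 * I₁r) * Y := by
      rw [hYdef]
      field_simp
    rw [e]
    exact mul_le_mul_of_nonneg_right key hY
  calc ENNReal.ofReal δ * (∫⁻ z, (Φ N).collisionPairSum (Ioc s t) (fun _ w i j =>
          ENNReal.ofReal (((N + 1 : ℕ) : ℝ)⁻¹ * (‖(w i).2‖ ^ 2 + ‖(w j).2‖ ^ 2) ^ 2)) z ∂P)
      ≤ ENNReal.ofReal δ * (ENNReal.ofReal (16 * τ * ((N + 1 : ℕ) : ℝ) ^ 2 * ε ^ 2) *
          (ENNReal.ofReal (((N + 1 : ℕ) : ℝ)⁻¹) * I₁)) := mul_le_mul_right hL _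
    _ = ENNReal.ofReal (δ * (16 * τ * ((N + 1 : ℕ) : ℝ) ^ 2 * ε ^ 2 *
          ((((N + 1 : ℕ) : ℝ))⁻¹ * I₁r))) := by
        rw [hI₁eq, ← ENNReal.ofReal_mul (by positivity), ← ENNReal.ofReal_mul (by positivity),
          ← ENNReal.ofReal_mul hδ.le]
    _ ≤ ENNReal.ofReal (κ₀ * Y) := ENNReal.ofReal_le_ofReal hZ
    _ ≤ R := hR

/-! ### The registered audit stub -/

/-- **Audit stub `stub_quarticSplitDeficitRung0` — the split deficit SD at GLOBAL EQUILIBRIUM (rung 0,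
with drift), with an `N`-independent `δ > 0`, for all `N ≥ N₀` and ALL windows `0 ≤ s ≤ t`.**  For
constant profiles `a, θ̄ > 0` and constant drift `u` there is `σ₀ > 0` such that for `0 < σ < σ₀` and
every flow family `Φ`:
`δ · E_{G_N}[Σ_{coll ∈ (s,t]} Σ_{i≠j in contact} (N+1)⁻¹(‖vᵢ⁺‖²+‖vⱼ⁺‖²)²]
   ≤ E_{G_N}[Σ_{coll ∈ (s,t]} Σ_{i≠j in contact} (N+1)⁻¹ 2‖vᵢ⁺‖²‖vⱼ⁺‖²]`.
Proof: `c5sd_core` (flux ceiling p98294 for the left functional and for the thin pair-energy shell;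
splitting floor `stub_splitFloorRung0`, p112692, and the one-collision comparison
`c5sd_splitIndicator_le` for the right functional), read on the routes' inline form on the conull good
set (`c5sd_finsum_eq_collisionPairSum`). [folklore] -/
theorem stub_quarticSplitDeficitRung0 :
    ∀ (a θb : ℝ) (u : V3), 0 < a → 0 < θb →
      ∃ σ₀ : ℝ, 0 < σ₀ ∧ ∀ σ : ℝ, 0 < σ → σ < σ₀ →
        ∀ Φ : ((N : ℕ) → HardSphereFlow (Torus.geometry (Fin 3)) (hsDiameter σ N) (N + 1)),
          ∃ δ : ℝ, 0 < δ ∧ ∃ N₀ : ℕ, ∀ N : ℕ, N₀ ≤ N → ∀ s t : ℝ, 0 ≤ s → s ≤ t →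
              ENNReal.ofReal δ *
                  (∫⁻ z, (∑ᶠ τ ∈ collisionTimes (Torus.geometry (Fin 3)) (hsDiameter σ N)
                  (fun r => (Φ N).flow r z) ∩ Set.Ioc s t,
                ∑ i : Fin (N + 1), ∑ j : Fin (N + 1), if i = j then (0 : ℝ≥0∞) else
                  (contactSet (Torus.geometry (Fin 3)) (N + 1) (hsDiameter σ N) i j).indicator
                    (fun y => ENNReal.ofReal (((N + 1 : ℕ) : ℝ)⁻¹ *
                      (‖(y i).2‖ ^ 2 + ‖(y j).2‖ ^ 2) ^ 2)) ((Φ N).flow τ z))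
                ∂(localGibbsLaw σ (fun _ => a) (fun _ => u) (fun _ => θb) N (Φ N)))
                ≤ (∫⁻ z, (∑ᶠ τ ∈ collisionTimes (Torus.geometry (Fin 3)) (hsDiameter σ N)
                  (fun r => (Φ N).flow r z) ∩ Set.Ioc s t,
                ∑ i : Fin (N + 1), ∑ j : Fin (N + 1), if i = j then (0 : ℝ≥0∞) else
                  (contactSet (Torus.geometry (Fin 3)) (N + 1) (hsDiameter σ N) i j).indicator
                    (fun y => ENNReal.ofReal (((N + 1 : ℕ) : ℝ)⁻¹ *
                      (2 * (‖(y i).2‖ ^ 2 * ‖(y j).2‖ ^ 2)))) ((Φ N).flow τ z))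
                ∂(localGibbsLaw σ (fun _ => a) (fun _ => u) (fun _ => θb) N (Φ N))) := by
  intro a θb u ha hθ
  obtain ⟨σ₀, hσ₀, hcore⟩ := c5sd_core a θb u ha hθ
  refine ⟨σ₀, hσ₀, fun σ hσ hσlt Φ => ?_⟩
  obtain ⟨δ, hδ, N₀, hN⟩ := hcore σ hσ hσlt Φ
  refine ⟨δ, hδ, N₀, fun N hN0 s t hs hst => ?_⟩
  have key := hN N hN0 s t hs hst
  have hgood := ae_mem_good_localGibbsLaw σ (fun _ => a) (fun _ => u) (fun _ => θb) N (Φ N)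
  convert key using 1
  · congr 1
    refine lintegral_congr_ae ?_
    filter_upwards [hgood] with z hz
    exact c5sd_finsum_eq_collisionPairSum (Φ N) hz (Set.Ioc s t)
      (fun y i j => ENNReal.ofReal (((N + 1 : ℕ) : ℝ)⁻¹ * (‖(y i).2‖ ^ 2 + ‖(y j).2‖ ^ 2) ^ 2))
  · refine lintegral_congr_ae ?_
    filter_upwards [hgood] with z hz
    exact c5sd_finsum_eq_collisionPairSum (Φ N) hz (Set.Ioc s t)
      (fun y i j => ENNReal.ofReal (((N + 1 : ℕ) : ℝ)⁻¹ * (2 * (‖(y i).2‖ ^ 2 * ‖(y j).2‖ ^ 2))))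

end Summit.AtomisticToContinuum.HydrodynamicLimit.Theorems.QuarticSchurLedger

end
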